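import Literature.Computability.QuantumComplexity.PauliExpansion
import Literature.Computability.Cryptography.QubitRegister
import Mathlib.LinearAlgebra.Matrix.Kronecker
import Mathlib.LinearAlgebra.Matrix.PosDef
import HarnessLib

/-!
# Pauli weights along a block of wires (Kempe–Regev–Unger–de Wolf, Observation 3 and §3)

The bookkeeping behind the induction step of Kempe–Regev–Unger–de Wolf, *Upper bounds on the noise
threshold for fault-tolerant quantum computing*, Quantum Inf. Comput. 10 (2010), §3: a gate acts on
a block of wires `e : Fin k ↪ Fin n`, and one has to see the register `Fin n → Bool` as the
product of the block register `QReg k = Fin k → Bool` with the register `Off e → Bool` of the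
remaining wires (`Off e = (range e)ᶜ`). Concretely:

* `splitFun e γ : (Fin n → γ) ≃ (Fin k → γ) × (Off e → γ)` — splitting labels (`γ = Bool`) and
  Pauli words (`γ = Pauli`) along the block (the `γ = Bool` case is the tree's `splitWires`);
* in these coordinates a tensor product `⊗ᵢ Aᵢ` is a Kronecker product (`reindex_tensorAll`),
  a Pauli string is `P_{S∘e} ⊗ₖ P_{S|off}` (`reindex_pauliString`) and a placed gate is
  `placeGate e U = U ⊗ₖ 1` (`reindex_placeGate`);
* `sliceK M B` — the partial trace of `M (1 ⊗ B)` over the second factor ("the coefficient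
  slice"): `Tr(sliceK M B · A) = Tr(M (A ⊗ B))` (`trace_sliceK_mul`), it commutes with block
  operators, `sliceK ((U ⊗ 1) M (V ⊗ 1)) B = U (sliceK M B) V` (`sliceK_kronecker_mul_mul_kronecker`),
  and for `B = 1` it is the reduced operator: positive semidefinite with the same trace
  (`posSemidef_sliceK_one`, `trace_sliceK_one`) — the `δ_V` of §3 and Observation 3;
* the **splitting formulas**: the Pauli coefficient of `M` at the word `(R on the block, S₀ off
  it)` is the coefficient at `R` of the slice of `M` against `P_{S₀}` (`pauliCoeff_split`), hence
  the Pauli weight of `M` on a wire set `W` meeting the block in `e(a)` is the sum over the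
  off-block words `S₀` supported in `W` of the weights on `a` of these slices
  (`pauliWeight_split`) — Observation 3 ("`δ̂(S I^{W∖V}) = δ̂_V(S)`") in the form used in
  Cases 1 and 2 of §3.1.2, and the action of a placed gate on the slices
  (`sliceK_reindex_placeGate_mul_mul`).

## References

* [KempeEtAl2010] J. Kempe, O. Regev, F. Unger, R. de Wolf, Quantum Inf. Comput. 10 (2010)
  361–376 (arXiv:0802.1464), §2 Observation 3, §3 (consistent sets, `δ_V`), §3.1.2 (the sums
  `Σ_{S ∈ 𝒫^{V∖A}} Σ_{R ∈ 𝒫^{A}} δ̂_V(RS)²`), read via `lit read doi:10.26421/qic10.5-6-1`, pp. 6–11.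
* M. A. Nielsen, I. L. Chuang, *Quantum Computation and Quantum Information*, §2.4.3 (reduced
  density operator, partial trace).
-/

noncomputable section

open scoped Classical Kronecker ComplexOrder
open Matrix Literature.Computability.Cryptography

namespace Literature.Computability.QuantumComplexity

/-! ### Generic: traces under reindexing, and the coefficient slice -/

section Slice

variable {α β : Type*}

/-- The trace is invariant under reindexing along an equivalence. [folklore] -/
theorem trace_reindex {m : Type*} [Fintype m] [Fintype α] (σ : m ≃ α) (M : Matrix m m ℂ) :
    (reindex σ σ M).trace = M.trace := by
  simp only [Matrix.trace, Matrix.diag_apply, reindex_apply, submatrix_apply]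
  exact σ.symm.sum_comp (fun i => M i i)

/-- Reindexing along an equivalence is multiplicative. [folklore] -/
theorem reindex_mul_reindex {m : Type*} [Fintype m] [Fintype α] (σ : m ≃ α) (M N : Matrix m m ℂ) :
    reindex σ σ M * reindex σ σ N = reindex σ σ (M * N) := by
  simp only [reindex_apply]
  exact submatrix_mul_equiv M N _ σ.symm _

variable [Fintype β]

/-- The **coefficient slice** of an operator `M` on a product register against an operator `B` on
the second factor: the partial trace over the second factor of `M (1 ⊗ B)`,
`(sliceK M B)_{a a'} = Σ_{z z'} M_{(a,z),(a',z')} B_{z' z}`. For `B = 1` this is the reduced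
operator `Tr₂ M` (Nielsen–Chuang §2.4.3; the `δ_V` of [KempeEtAl2010, §3]).
[cite: KempeEtAl2010, §3 (ρ_V: tracing out all qubits that are not in V) and Observation 3] -/
def sliceK (M : Matrix (α × β) (α × β) ℂ) (B : Matrix β β ℂ) : Matrix α α ℂ :=
  Matrix.of fun a a' => ∑ z, ∑ z', M (a, z) (a', z') * B z' z

/-- Entries of `sliceK`. [folklore] -/
theorem sliceK_apply (M : Matrix (α × β) (α × β) ℂ) (B : Matrix β β ℂ) (a a' : α) :
    sliceK M B a a' = ∑ z, ∑ z', M (a, z) (a', z') * B z' z := rfl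

/-- `sliceK` is additive in the operator. [folklore] -/
theorem sliceK_add (M N : Matrix (α × β) (α × β) ℂ) (B : Matrix β β ℂ) :
    sliceK (M + N) B = sliceK M B + sliceK N B := by
  ext a a'
  simp only [sliceK_apply, Matrix.add_apply, add_mul, Finset.sum_add_distrib]

/-- `sliceK` is subtractive in the operator. [folklore] -/
theorem sliceK_sub (M N : Matrix (α × β) (α × β) ℂ) (B : Matrix β β ℂ) :
    sliceK (M - N) B = sliceK M B - sliceK N B := by
  ext a a'
  simp only [sliceK_apply, Matrix.sub_apply, sub_mul, Finset.sum_sub_distrib]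

/-- `sliceK` is homogeneous in the operator. [folklore] -/
theorem sliceK_smul (c : ℂ) (M : Matrix (α × β) (α × β) ℂ) (B : Matrix β β ℂ) :
    sliceK (c • M) B = c • sliceK M B := by
  ext a a'
  simp only [sliceK_apply, Matrix.smul_apply, smul_eq_mul, Finset.mul_sum, mul_assoc]

/-- `sliceK` commutes with finite sums of operators. [folklore] -/
theorem sliceK_sum {κ : Type*} (s : Finset κ) (M : κ → Matrix (α × β) (α × β) ℂ) (B : Matrix β β ℂ) :
    sliceK (∑ i ∈ s, M i) B = ∑ i ∈ s, sliceK (M i) B := by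
  induction s using Finset.induction_on with
  | empty =>
    ext a a'
    simp [sliceK_apply]
  | insert x s hx ih => rw [Finset.sum_insert hx, Finset.sum_insert hx, sliceK_add, ih]

variable [Fintype α]

/-- **Duality**: `Tr(sliceK M B · A) = Tr(M (A ⊗ B))` — the slice against `B` carries exactly the
coefficients of `M` along `· ⊗ B`. [cite: KempeEtAl2010, Observation 3] -/
theorem trace_sliceK_mul (M : Matrix (α × β) (α × β) ℂ) (B : Matrix β β ℂ) (A : Matrix α α ℂ) :
    (sliceK M B * A).trace = (M * (A ⊗ₖ B)).trace := by
  simp only [Matrix.trace, Matrix.diag_apply, Matrix.mul_apply, sliceK_apply,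
    kroneckerMap_apply, Fintype.sum_prod_type, Finset.sum_mul]
  refine Finset.sum_congr rfl fun a _ => ?_
  rw [Finset.sum_comm]
  refine Finset.sum_congr rfl fun z _ => ?_
  refine Finset.sum_congr rfl fun a' _ => Finset.sum_congr rfl fun z' _ => by ring

/-- The same duality with the other order: `Tr(A · sliceK M B) = Tr((A ⊗ B) M)`. [folklore] -/
theorem trace_mul_sliceK (M : Matrix (α × β) (α × β) ℂ) (B : Matrix β β ℂ) (A : Matrix α α ℂ) :
    (A * sliceK M B).trace = ((A ⊗ₖ B) * M).trace := by
  rw [trace_mul_comm, trace_sliceK_mul, trace_mul_comm]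

/-- A matrix is determined by its traces against all matrices. [folklore] -/
theorem ext_of_trace_mul {X Y : Matrix α α ℂ} (h : ∀ A : Matrix α α ℂ, (X * A).trace = (Y * A).trace) :
    X = Y := by
  classical
  ext i j
  have hij := h (Matrix.single j i 1)
  rwa [trace_mul_single, trace_mul_single, MulOpposite.op_one, one_smul, one_smul] at hij

variable [DecidableEq β]

/-- **Block operators pass through the slice**: `sliceK ((U ⊗ 1) M (V ⊗ 1)) B = U (sliceK M B) V`
(the partial trace over the untouched wires commutes with operators on the block).
[cite: KempeEtAl2010, §3.1.2 (G maps δ_{V'} to δ_{V''∪A''})] -/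
theorem sliceK_kronecker_mul_mul_kronecker (U V : Matrix α α ℂ) (M : Matrix (α × β) (α × β) ℂ)
    (B : Matrix β β ℂ) :
    sliceK ((U ⊗ₖ (1 : Matrix β β ℂ)) * M * (V ⊗ₖ (1 : Matrix β β ℂ))) B = U * sliceK M B * V := by
  refine ext_of_trace_mul fun A => ?_
  calc (sliceK ((U ⊗ₖ (1 : Matrix β β ℂ)) * M * (V ⊗ₖ (1 : Matrix β β ℂ))) B * A).trace
      = ((U ⊗ₖ (1 : Matrix β β ℂ)) * (M * ((V ⊗ₖ (1 : Matrix β β ℂ)) * (A ⊗ₖ B)))).trace := by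
        rw [trace_sliceK_mul]
        simp only [Matrix.mul_assoc]
    _ = (M * ((V ⊗ₖ (1 : Matrix β β ℂ)) * (A ⊗ₖ B) * (U ⊗ₖ (1 : Matrix β β ℂ)))).trace := by
        rw [trace_mul_comm]
        simp only [Matrix.mul_assoc]
    _ = (M * ((V * A * U) ⊗ₖ B)).trace := by
        rw [← mul_kronecker_mul, Matrix.one_mul, ← mul_kronecker_mul, Matrix.mul_one]
    _ = (sliceK M B * (V * A * U)).trace := by rw [trace_sliceK_mul]
    _ = (U * sliceK M B * V * A).trace := by
        rw [← Matrix.mul_assoc, ← Matrix.mul_assoc, trace_mul_cycle, ← Matrix.mul_assoc]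

variable [DecidableEq α]

/-- The restriction `⟨a, z| ↦ ⟨a|` at a fixed label `z` of the second factor. [folklore] -/
def restrictAt (z : β) : Matrix α (α × β) ℂ :=
  Matrix.of fun a p => if p = (a, z) then 1 else 0

omit [Fintype β] [Fintype α] in
/-- Entries of `restrictAt`. [folklore] -/
theorem restrictAt_apply (z : β) (a : α) (p : α × β) :
    restrictAt (α := α) z a p = if p = (a, z) then 1 else 0 := rfl

/-- Left multiplication by the restriction picks a row block. [folklore] -/
theorem restrictAt_mul_apply (z : β) (M : Matrix (α × β) (α × β) ℂ) (a : α) (q : α × β) :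
    (restrictAt (α := α) z * M) a q = M (a, z) q := by
  rw [Matrix.mul_apply, Finset.sum_eq_single (a, z)]
  · rw [restrictAt_apply, if_pos rfl, one_mul]
  · intro p _ hp
    rw [restrictAt_apply, if_neg hp, zero_mul]
  · intro h
    exact absurd (Finset.mem_univ _) h

/-- The compression to a fixed label of the second factor. [folklore] -/
theorem restrictAt_mul_mul_conjTranspose_apply (z : β) (M : Matrix (α × β) (α × β) ℂ) (a a' : α) :
    (restrictAt (α := α) z * M * (restrictAt (α := α) z)ᴴ) a a' = M (a, z) (a', z) := by
  rw [Matrix.mul_apply, Finset.sum_eq_single (a', z)]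
  · rw [restrictAt_mul_apply, conjTranspose_apply, restrictAt_apply, if_pos rfl, star_one, mul_one]
  · intro q _ hq
    rw [conjTranspose_apply, restrictAt_apply, if_neg hq, star_zero, mul_zero]
  · intro h
    exact absurd (Finset.mem_univ _) h

/-- The reduced operator as a sum of compressions: `Tr₂ M = Σ_z R_z M R_z†`.
(Nielsen–Chuang §2.4.3.) [folklore] -/
theorem sliceK_one_eq_sum (M : Matrix (α × β) (α × β) ℂ) :
    sliceK M 1 = ∑ z, restrictAt (α := α) z * M * (restrictAt (α := α) z)ᴴ := by
  ext a a'
  rw [sliceK_apply, Matrix.sum_apply]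
  refine Finset.sum_congr rfl fun z _ => ?_
  rw [restrictAt_mul_mul_conjTranspose_apply, Finset.sum_eq_single z]
  · rw [one_apply_eq, mul_one]
  · intro w _ hw
    rw [one_apply_ne hw, mul_zero]
  · intro h
    exact absurd (Finset.mem_univ _) h

omit [DecidableEq α] in
/-- **The reduced operator of a positive operator is positive.** (Nielsen–Chuang §2.4.3.)
[folklore] -/
theorem posSemidef_sliceK_one {M : Matrix (α × β) (α × β) ℂ} (hM : M.PosSemidef) :
    (sliceK M 1).PosSemidef := by
  classical
  rw [sliceK_one_eq_sum]
  exact posSemidef_sum _ fun z _ => hM.mul_mul_conjTranspose_same _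

omit [DecidableEq α] in
/-- **The reduced operator has the same trace.** (Nielsen–Chuang §2.4.3.) [folklore] -/
theorem trace_sliceK_one (M : Matrix (α × β) (α × β) ℂ) : (sliceK M 1).trace = M.trace := by
  rw [← Matrix.mul_one (sliceK M 1), trace_sliceK_mul, one_kronecker_one, Matrix.mul_one]

end Slice

/-! ### Splitting along a block of wires -/

section Split

variable {n k : ℕ} (e : Fin k ↪ Fin n)

/-- The wires off the block `e`. [folklore] -/
abbrev Off : Type := ((Set.range e)ᶜ : Set (Fin n))

/-- **Splitting along a block**: a function on the wires is the pair of its restrictions to the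
block (reindexed by `Fin k` along `e`) and to the remaining wires. For `γ = Bool` this is the
label splitting `splitWires` of `QubitRegister.lean`; for `γ = Pauli` it splits Pauli words.
[folklore] -/
def splitFun (γ : Type*) : (Fin n → γ) ≃ (Fin k → γ) × (Off e → γ) :=
  ((Equiv.arrowCongr (Equiv.Set.sumCompl (Set.range e)) (Equiv.refl γ)).symm.trans
    (Equiv.sumArrowEquivProdArrow _ _ γ)).trans
    (Equiv.prodCongr (Equiv.arrowCongr (Equiv.ofInjective e e.injective).symm (Equiv.refl γ))
      (Equiv.refl _))

variable {e} {γ : Type*}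

/-- First component of the splitting: restriction to the block. [folklore] -/
@[simp] theorem splitFun_fst (f : Fin n → γ) : (splitFun e γ f).1 = f ∘ e := by
  funext j
  simp [splitFun]

/-- Second component of the splitting: restriction off the block. [folklore] -/
@[simp] theorem splitFun_snd (f : Fin n → γ) (l : Off e) : (splitFun e γ f).2 l = f l := by
  simp [splitFun]

/-- The merged function restricted to the block. [folklore] -/
@[simp] theorem splitFun_symm_apply_apply (g : Fin k → γ) (h : Off e → γ) (j : Fin k) :
    (splitFun e γ).symm (g, h) (e j) = g j := by
  have := congrArg Prod.fst ((splitFun e γ).apply_symm_apply (g, h))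
  rw [splitFun_fst] at this
  exact congrFun this j

/-- The merged function off the block. [folklore] -/
@[simp] theorem splitFun_symm_apply_coe (g : Fin k → γ) (h : Off e → γ) (l : Off e) :
    (splitFun e γ).symm (g, h) l = h l := by
  have := congrFun (congrArg Prod.snd ((splitFun e γ).apply_symm_apply (g, h))) l
  rw [splitFun_snd] at this
  exact this

/-- A product over all wires splits into the block part and the rest. [folklore] -/
theorem prod_eq_prod_block_mul_prod_off (F : Fin n → ℂ) :
    ∏ i, F i = (∏ j : Fin k, F (e j)) * ∏ l : Off e, F l := by
  rw [← Fintype.prod_equiv (Equiv.Set.sumCompl (Set.range e))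
    (fun s => F (Equiv.Set.sumCompl (Set.range e) s)) F (fun _ => rfl), Fintype.prod_sum_type]
  simp only [Equiv.Set.sumCompl_apply_inl, Equiv.Set.sumCompl_apply_inr]
  congr 1
  exact Fintype.prod_equiv (Equiv.ofInjective e e.injective).symm (fun x => F x) (fun j => F (e j))
    fun x => by rw [← Equiv.apply_ofInjective_symm e.injective x]

/-- **Tensor products in block coordinates are Kronecker products**:
`⊗ᵢ Aᵢ = (⊗_{j<k} A_{e j}) ⊗ₖ (⊗_{l off} A_l)`. (Nielsen–Chuang §2.1.7.) [folklore] -/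
theorem reindex_tensorAll (A : Fin n → Matrix Bool Bool ℂ) :
    reindex (splitFun e Bool) (splitFun e Bool) (tensorAll A) =
      tensorAll (A ∘ e) ⊗ₖ tensorAll (fun l : Off e => A l) := by
  ext p q
  obtain ⟨g, h⟩ := p
  obtain ⟨g', h'⟩ := q
  rw [reindex_apply, submatrix_apply, tensorAll_apply, kroneckerMap_apply, tensorAll_apply,
    tensorAll_apply, prod_eq_prod_block_mul_prod_off (e := e)]
  congr 1
  · exact Finset.prod_congr rfl fun j _ => by
      rw [Function.comp_apply, splitFun_symm_apply_apply, splitFun_symm_apply_apply]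
  · exact Finset.prod_congr rfl fun l _ => by
      rw [splitFun_symm_apply_coe, splitFun_symm_apply_coe]

/-- In block coordinates a Pauli string is `P_{S∘e} ⊗ₖ P_{S|off}`.
[cite: KempeEtAl2010, §3.1.2 (the words RS, R ∈ 𝒫^A, S ∈ 𝒫^{V∖A})] -/
theorem reindex_pauliString (S : Fin n → Pauli) :
    reindex (splitFun e Bool) (splitFun e Bool) (pauliString S) =
      pauliString (S ∘ e) ⊗ₖ pauliString (fun l : Off e => S l) := by
  rw [pauliString_eq, reindex_tensorAll]
  rfl

/-- The Pauli string of a merged word. [folklore] -/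
theorem reindex_pauliString_symm (R : Fin k → Pauli) (S₀ : Off e → Pauli) :
    reindex (splitFun e Bool) (splitFun e Bool) (pauliString ((splitFun e Pauli).symm (R, S₀))) =
      pauliString R ⊗ₖ pauliString S₀ := by
  rw [reindex_pauliString]
  have h1 : ((splitFun e Pauli).symm (R, S₀)) ∘ e = R :=
    funext fun j => splitFun_symm_apply_apply R S₀ j
  have h2 : (fun l : Off e => (splitFun e Pauli).symm (R, S₀) l) = S₀ :=
    funext fun l => splitFun_symm_apply_coe R S₀ l
  rw [h1, h2]

/-- **A placed gate in block coordinates is `U ⊗ 1`.** (Nielsen–Chuang §4.3; compare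
`placeGate_eq_reindex_kronecker` of `QubitRegister.lean`, stated with `splitWires`.) [folklore] -/
theorem reindex_placeGate (U : Matrix (QReg k) (QReg k) ℂ) :
    reindex (splitFun e Bool) (splitFun e Bool) (placeGate e U) =
      U ⊗ₖ (1 : Matrix (Off e → Bool) (Off e → Bool) ℂ) := by
  ext p q
  obtain ⟨g, h⟩ := p
  obtain ⟨g', h'⟩ := q
  rw [reindex_apply, submatrix_apply, placeGate_apply, kroneckerMap_apply, one_apply]
  have h1 : ((splitFun e Bool).symm (g, h)) ∘ e = g := funext fun j => splitFun_symm_apply_apply g h j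
  have h2 : ((splitFun e Bool).symm (g', h')) ∘ e = g' :=
    funext fun j => splitFun_symm_apply_apply g' h' j
  rw [h1, h2]
  by_cases hh : h = h'
  · subst hh
    rw [if_pos, if_pos rfl, mul_one]
    intro i hi
    have := splitFun_symm_apply_coe g h ⟨i, hi⟩
    have h' := splitFun_symm_apply_coe g' h ⟨i, hi⟩
    simp only at this h'
    rw [this, h']
  · rw [if_neg hh, mul_zero, if_neg]
    intro H
    apply hh
    funext l
    have h3 := H l l.2
    rwa [splitFun_symm_apply_coe g h l, splitFun_symm_apply_coe g' h' l] at h3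

/-! ### The splitting formulas -/

/-- Notation-saving abbreviation: the operator `M` in block coordinates. [folklore] -/
abbrev blockForm (e : Fin k ↪ Fin n) (M : Matrix (Fin n → Bool) (Fin n → Bool) ℂ) :
    Matrix (QReg k × (Off e → Bool)) (QReg k × (Off e → Bool)) ℂ :=
  reindex (splitFun e Bool) (splitFun e Bool) M

/-- **Coefficient splitting** (Observation 3 in block form): the Pauli coefficient of `M` at the
merged word `(R, S₀)` is the coefficient at `R` of the slice of `M` against `P_{S₀}`:
`Tr(P_{(R,S₀)} M) = Tr(P_R · sliceK M̃ P_{S₀})`. [cite: KempeEtAl2010, Observation 3 and §3.1.2] -/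
theorem pauliCoeff_split (M : Matrix (Fin n → Bool) (Fin n → Bool) ℂ) (R : Fin k → Pauli)
    (S₀ : Off e → Pauli) :
    pauliCoeff M ((splitFun e Pauli).symm (R, S₀)) =
      pauliCoeff (sliceK (blockForm e M) (pauliString S₀)) R := by
  rw [pauliCoeff_eq, pauliCoeff_eq, trace_mul_sliceK, ← reindex_pauliString_symm,
    reindex_mul_reindex, trace_reindex]

/-- **A placed gate acts on the slices by conjugation**:
`sliceK (U_e M V_e)~ B = U (sliceK M̃ B) V`. [cite: KempeEtAl2010, §3.1.2 (Case 1: G maps δ_{V'} to δ_{V''∪A''})] -/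
theorem sliceK_blockForm_placeGate_mul_mul (U V : Matrix (QReg k) (QReg k) ℂ)
    (M : Matrix (Fin n → Bool) (Fin n → Bool) ℂ) (B : Matrix (Off e → Bool) (Off e → Bool) ℂ) :
    sliceK (blockForm e (placeGate e U * M * placeGate e V)) B = U * sliceK (blockForm e M) B * V := by
  rw [blockForm, ← reindex_mul_reindex, ← reindex_mul_reindex, reindex_placeGate,
    reindex_placeGate, sliceK_kronecker_mul_mul_kronecker]

/-- The adjoint of a placed gate is the placed adjoint. [folklore] -/
theorem conjTranspose_placeGate (U : Matrix (QReg k) (QReg k) ℂ) :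
    (placeGate e U)ᴴ = placeGate e Uᴴ := by
  have h1 := reindex_placeGate (e := e) U
  have h2 := reindex_placeGate (e := e) Uᴴ
  have : reindex (splitFun e Bool) (splitFun e Bool) (placeGate e U)ᴴ =
      reindex (splitFun e Bool) (splitFun e Bool) (placeGate e Uᴴ) := by
    rw [← conjTranspose_reindex, h1, h2, conjTranspose_kronecker, conjTranspose_one]
  exact (reindex (splitFun e Bool) (splitFun e Bool)).injective this

/-- Membership of a merged word in `stringsOn W`, when `W` meets the block in `e(a)` and the
other wires in `W'`. [folklore] -/
theorem splitFun_symm_mem_stringsOn {W : Finset (Fin n)} {a : Finset (Fin k)} {W' : Finset (Off e)}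
    (ha : ∀ j, e j ∈ W ↔ j ∈ a) (hW' : ∀ l : Off e, (l : Fin n) ∈ W ↔ l ∈ W')
    (R : Fin k → Pauli) (S₀ : Off e → Pauli) :
    (splitFun e Pauli).symm (R, S₀) ∈ stringsOn W ↔ R ∈ stringsOn a ∧ S₀ ∈ stringsOn W' := by
  simp only [mem_stringsOn]
  constructor
  · intro h
    refine ⟨fun j hj => ?_, fun l hl => ?_⟩
    · have := h (e j) fun h' => hj ((ha j).mp h')
      rwa [splitFun_symm_apply_apply] at this
    · have := h l fun h' => hl ((hW' l).mp h')
      rwa [splitFun_symm_apply_coe] at this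
  · rintro ⟨hR, hS⟩ i hi
    by_cases hmem : i ∈ Set.range e
    · obtain ⟨j, rfl⟩ := hmem
      rw [splitFun_symm_apply_apply]
      exact hR j fun hj => hi ((ha j).mpr hj)
    · have := splitFun_symm_apply_coe R S₀ ⟨i, hmem⟩
      simp only at this
      rw [this]
      exact hS ⟨i, hmem⟩ fun hl => hi ((hW' ⟨i, hmem⟩).mpr hl)

/-- **Weight splitting** (Cases 1–2 of §3.1.2 in block form): if the wire set `W` meets the block
in `e(a)` and the remaining wires in `W'`, then
`Σ_{S ∈ stringsOn W} |Tr(P_S M)|² = Σ_{S₀ ∈ stringsOn W'} Σ_{R ∈ stringsOn a} |Tr(P_R · sliceK M̃ P_{S₀})|²`.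
[cite: KempeEtAl2010, §3.1.2 (Σ_{S∈𝒫^{V'}} δ̂_{V'}(S)² = Σ_{S∈𝒫^{V'∖A'}} Σ_{R∈𝒫^{A'}} δ̂_{V'}(RS)²)] -/
theorem pauliWeight_split (M : Matrix (Fin n → Bool) (Fin n → Bool) ℂ) {W : Finset (Fin n)}
    {a : Finset (Fin k)} {W' : Finset (Off e)} (ha : ∀ j, e j ∈ W ↔ j ∈ a)
    (hW' : ∀ l : Off e, (l : Fin n) ∈ W ↔ l ∈ W') :
    pauliWeight M W =
      ∑ S₀ ∈ stringsOn W', pauliWeight (sliceK (blockForm e M) (pauliString S₀)) a := by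
  rw [pauliWeight_eq]
  -- rewrite the right side as a sum over pairs, then transport along `splitFun e Pauli`
  have hrhs : ∑ S₀ ∈ stringsOn W', pauliWeight (sliceK (blockForm e M) (pauliString S₀)) a =
      ∑ p ∈ stringsOn a ×ˢ stringsOn W',
        ‖pauliCoeff (sliceK (blockForm e M) (pauliString p.2)) p.1‖ ^ 2 := by
    rw [Finset.sum_product_right]
    rfl
  rw [hrhs]
  refine Finset.sum_equiv (splitFun e Pauli) (fun S => ?_) (fun S hS => ?_)
  · rw [Finset.mem_product]
    have h := splitFun_symm_mem_stringsOn ha hW' (splitFun e Pauli S).1 (splitFun e Pauli S).2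
    rwa [Prod.mk.eta, Equiv.symm_apply_apply] at h
  · have h := pauliCoeff_split (e := e) M (splitFun e Pauli S).1 (splitFun e Pauli S).2
    rw [Prod.mk.eta, Equiv.symm_apply_apply] at h
    rw [h]

end Split

end Literature.Computability.QuantumComplexity

end
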